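import Literature.NumberTheory.EllipticCurves.CyclotomicLayerPairingOfFun
import Literature.NumberTheory.GaloisRepresentations.ContinuousShapiroLiftMackeyCup
import Literature.NumberTheory.GaloisRepresentations.ConjugationDescent
import HarnessLib

/-!
# The local term at a finite place `v` of the GLOBAL Shapiro cup class `Sh_{Γ_n} a ∪_{Σe} Sh_{Γ_n} b ∈ H²(Γ_ℚ, μ_N)`, ALL ORBITS:
# `inv_v(loc_v(Sh a ∪ Sh b)) = Σ_i ⟨loc_n(g_i · a), loc_n(g_i · b)⟩_{n,N,v}` — Mackey's formula read in the layer-pairing currency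

Topic `NumberTheory/EllipticCurves`, sub-namespace `CyclotomicLayer` (as `CyclotomicLayerPairingOfFun.lean`). THEOREMS ONLY (no definition,
no named fact, no instance, no `sorry`). For a finite discrete `Γ_ℚ`-module `M` with a pairing `e : M × M → μ_N`
(`contPairingOfFun`), the cyclotomic `ℤ_p`-tower `κ`, a layer `Γ_n = κ.layerSubgroup n`, a finite place `v` (ANY — split, inert or
ramified in `ℚ_n`), `θ = resGalOfEmb (closureEmb ℚ_v) : Γ_v → Γ_ℚ`, `U_n = layerGroup κ v n = θ⁻¹Γ_n`, and ORBIT REPRESENTATIVES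
`g : ι → Γ_ℚ` of the `Γ_v`-action on `Γ_ℚ ⧸ Γ_n` (bijection `(i, y') ↦ ē(y')·g_iΓ_n`, `ē = quotientMapOfHom`; `#ι` = number of places of
`ℚ_n` above `v`):

* **`invAt_localization_cupProduct_shapiroLift_eq_sum`** — `inv_v(loc_v(Sh_{Γ_n} a ∪_{Σe} Sh_{Γ_n} b)) = Σ_i layerPairingH1Of … n
  (layerLocOf (g_i · a)) (layerLocOf (g_i · b))`, `g · a = conjMap … g 1 a`: the generic all-orbit Mackey cup formula
  `ContPairing.map_cupProduct_coindFin_shapiroLift_sum` (`GaloisRepresentations/ContinuousShapiroLiftMackeyCup.lean`) READ in the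
  layer-pairing currency of `CyclotomicLayerPairingOfFun.lean` (`layerLocOf`, `layerShapiroOf`, `layerSumPairingOf`, `layerPairingH1Of` —
  all definitionally the generic Shapiro objects for `θ`), for any representatives `s` of `Γ_ℚ ⧸ Γ_n`;
  `map_cupProduct_shapiroLift_eq_sum` — the same before `inv_v`, in `H²(Γ_v, μ_N|)`.
* **`invAt_localization_cupProduct_shapiroLift_eq_of_surjective`** — ONE orbit (`θ(Γ_v)·Γ_n = Γ_ℚ`, e.g. `v ∣ p` totally ramified, or
  `v` inert in `ℚ_n`): `inv_v(loc_v(Sh a ∪ Sh b)) = ⟨loc_n a, loc_n b⟩_{n,N,v}` (no conjugation: `conjMap_one_one`).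

Consumer: the reciprocity stub (EH) of crux RSL_g `ResidualSignedLambdaLowerCMAtTwo` (`Summits/BirchSwinnertonDyer`): this is the hypothesis
`hloc` of `ReciprocityReceptacle.two_nsmul_sum_orbit_layerPairingH1Of_eq_zero` / `sum_orbit_layerPairingH1Of_eq_zero_of_localization_inl_eq_zero`
DISCHARGED at every `v ∈ {2} ∪ S₀` (STUB-PLAN rev 13 S52, the `(M)` step); the orbit terms are then the pinned values K-c (`v = 2`) / K-d (`w ∈ S₀`).

References: [Brown1982] III §5 (5.6)(b); [NeukirchSchmidtWingberg2008] I §5 Prop. (1.5.3), (1.5.6)–(1.5.7), I §6 Prop. (1.6.4);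
[Kobayashi2003] (8.23) (p. 18); [MilneADT2006] I §6 (proof of Prop. 6.9).
-/

set_option autoImplicit false

noncomputable section

open scoped Classical

namespace Literature.NumberTheory.EllipticCurves

namespace CyclotomicLayer

open CategoryTheory Field NumberField IsDedekindDomain
  Literature.NumberTheory.GaloisRepresentations Literature.NumberTheory.GaloisCohomology ZpExtension
open Literature.NumberTheory.GaloisRepresentations.DiscreteGaloisModule (mu MuCarrier)

-- Cup products need `LocallyCompactSpace Γ`: the (Prop-valued) compactness of the two absolute Galois groups is taken as an INSTANCE
-- BINDER of each statement (supply `absoluteGaloisGroup_compactSpace _`); no local instance attribute.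

universe w

variable {M : Type} [AddCommGroup M] [TopologicalSpace M] [DiscreteTopology M]
  (ρM : DiscreteGaloisModule ℚ M) (N : ℕ) [NeZero N]
  (e : M → M → AlgebraicClosure ℚ)
  (hμ : ∀ S T, e S T ^ N = 1)
  (hadd₁ : ∀ S₁ S₂ T, e (S₁ + S₂) T = e S₁ T * e S₂ T)
  (hadd₂ : ∀ S T₁ T₂, e S (T₁ + T₂) = e S T₁ * e S T₂)
  (hgal : ∀ (σ : absoluteGaloisGroup ℚ) (S T : M), σ • e S T = e (ρM σ S) (ρM σ T))
  {p : ℕ} [Fact p.Prime] (κ : ZpExtension ℚ p) (v : HeightOneSpectrum (𝓞 ℚ)) (n : ℕ)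

/-- **Mackey's formula for the restriction to `Γ_v` of the global Shapiro cup class, in the layer-pairing currency** (all orbits, any
representatives `s` of `Γ_ℚ ⧸ Γ_n`): `loc_v(Sh_{Γ_n} a ∪_{Σe} Sh_{Γ_n} b) = Σ_i layerShapiroOf(loc_n(g_i · a)) ∪_{Σe_v} layerShapiroOf(loc_n(g_i · b))`
in `H²(Γ_v, μ_N|)`. [cite: Brown1982, III §5 (5.6)(b)] [cite: NeukirchSchmidtWingberg2008, I §5 Prop. (1.5.3), (1.5.6)–(1.5.7) and I §6 Prop. (1.6.4)] -/
theorem map_cupProduct_shapiroLift_eq_sum [CompactSpace (absoluteGaloisGroup ℚ)]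
    [CompactSpace (absoluteGaloisGroup (v.adicCompletion ℚ))] [Fintype (absoluteGaloisGroup ℚ ⧸ κ.layerSubgroup n)]
    {s : absoluteGaloisGroup ℚ ⧸ κ.layerSubgroup n → absoluteGaloisGroup ℚ}
    (hs : ∀ y, (s y : absoluteGaloisGroup ℚ ⧸ κ.layerSubgroup n) = y)
    (hs1 : s ((1 : absoluteGaloisGroup ℚ) : absoluteGaloisGroup ℚ ⧸ κ.layerSubgroup n) = 1)
    {ι : Type w} [Fintype ι] (g : ι → absoluteGaloisGroup ℚ)
    (hbij : Function.Bijective fun q : ι × (absoluteGaloisGroup (v.adicCompletion ℚ) ⧸ layerGroup κ v n) =>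
      quotientMapOfHom (κ.layerSubgroup n) (resGalOfEmb (closureEmb (K := ℚ) (v.adicCompletion ℚ))) q.2 *
        (g q.1 : absoluteGaloisGroup ℚ ⧸ κ.layerSubgroup n))
    (a b : H1 ρM (κ.layerSubgroup n)) :
    ContinuousCohomology.map (resGalOfEmb (closureEmb (K := ℚ) (v.adicCompletion ℚ)))
        (𝟙 (TopRep.res (resGalOfEmb (closureEmb (K := ℚ) (v.adicCompletion ℚ)) :
          absoluteGaloisGroup (v.adicCompletion ℚ) →* absoluteGaloisGroup ℚ) (mu ℚ N).toTopRep)) 2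
        (((contPairingOfFun ρM N e hμ hadd₁ hadd₂ hgal).coindFin (κ.layerSubgroup n)).cupProduct
          (shapiroLift ρM.toTopRep (κ.layerSubgroup n) (κ.isOpen_layerSubgroup n) hs hs1 a)
          (shapiroLift ρM.toTopRep (κ.layerSubgroup n) (κ.isOpen_layerSubgroup n) hs hs1 b)) =
      ∑ i, (layerSumPairingOf ρM N e hμ hadd₁ hadd₂ hgal κ v n).cupProduct
        (layerShapiroOf ρM κ v n (layerLocOf ρM κ v n (conjMap ρM.toTopRep (κ.layerSubgroup n) (g i) 1 a)))
        (layerShapiroOf ρM κ v n (layerLocOf ρM κ v n (conjMap ρM.toTopRep (κ.layerSubgroup n) (g i) 1 b))) := by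
  letI : Fintype (absoluteGaloisGroup (v.adicCompletion ℚ) ⧸
      (κ.layerSubgroup n).comap ((resGalOfEmb (closureEmb (K := ℚ) (v.adicCompletion ℚ)) :
        absoluteGaloisGroup (v.adicCompletion ℚ) →* absoluteGaloisGroup ℚ))) :=
    layerFintypeQuot κ v n
  exact ContPairing.map_cupProduct_coindFin_shapiroLift_sum (contPairingOfFun ρM N e hμ hadd₁ hadd₂ hgal) (κ.layerSubgroup n)
    (resGalOfEmb (closureEmb (K := ℚ) (v.adicCompletion ℚ))) (κ.isOpen_layerSubgroup n) g hbij hs hs1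
    (layerReps_spec κ v n) (layerReps_one κ v n) a b

/-- **`inv_v(loc_v(Sh_{Γ_n} a ∪_{Σe} Sh_{Γ_n} b)) = Σ_i ⟨loc_n(g_i · a), loc_n(g_i · b)⟩_{n,N,v}`** — the local term at ANY finite place `v` of
Tate's reciprocity law for the global Shapiro cup class is the ORBIT SUM of the layer pairings (`layerPairingH1Of`) of the conjugates, for
orbit representatives `g` of the `Γ_v`-action on `Γ_ℚ ⧸ Γ_n` (the `2^{min(n, n_v)}` places of `ℚ_n` above `v`). This is the hypothesis
`hloc` of the levelwise reciprocity assembly, discharged. [cite: Kobayashi2003, (8.23) (p. 18)] [cite: MilneADT2006, Ch. I §6, proof of Prop. 6.9]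
[cite: NeukirchSchmidtWingberg2008, I §5 (1.5.6)–(1.5.7)] -/
theorem invAt_localization_cupProduct_shapiroLift_eq_sum [CompactSpace (absoluteGaloisGroup ℚ)]
    [CompactSpace (absoluteGaloisGroup (v.adicCompletion ℚ))] [Fintype (absoluteGaloisGroup ℚ ⧸ κ.layerSubgroup n)]
    {s : absoluteGaloisGroup ℚ ⧸ κ.layerSubgroup n → absoluteGaloisGroup ℚ}
    (hs : ∀ y, (s y : absoluteGaloisGroup ℚ ⧸ κ.layerSubgroup n) = y)
    (hs1 : s ((1 : absoluteGaloisGroup ℚ) : absoluteGaloisGroup ℚ ⧸ κ.layerSubgroup n) = 1)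
    {ι : Type w} [Fintype ι] (g : ι → absoluteGaloisGroup ℚ)
    (hbij : Function.Bijective fun q : ι × (absoluteGaloisGroup (v.adicCompletion ℚ) ⧸ layerGroup κ v n) =>
      quotientMapOfHom (κ.layerSubgroup n) (resGalOfEmb (closureEmb (K := ℚ) (v.adicCompletion ℚ))) q.2 *
        (g q.1 : absoluteGaloisGroup ℚ ⧸ κ.layerSubgroup n))
    (a b : H1 ρM (κ.layerSubgroup n)) :
    invAt N v (galoisCohomology.localization (mu ℚ N) (Sum.inr v) 2
        (((contPairingOfFun ρM N e hμ hadd₁ hadd₂ hgal).coindFin (κ.layerSubgroup n)).cupProduct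
          (shapiroLift ρM.toTopRep (κ.layerSubgroup n) (κ.isOpen_layerSubgroup n) hs hs1 a)
          (shapiroLift ρM.toTopRep (κ.layerSubgroup n) (κ.isOpen_layerSubgroup n) hs hs1 b))) =
      ∑ i, layerPairingH1Of ρM N e hμ hadd₁ hadd₂ hgal κ v n
        (layerLocOf ρM κ v n (conjMap ρM.toTopRep (κ.layerSubgroup n) (g i) 1 a))
        (layerLocOf ρM κ v n (conjMap ρM.toTopRep (κ.layerSubgroup n) (g i) 1 b)) := by
  have h := congrArg (invAt N v) (map_cupProduct_shapiroLift_eq_sum ρM N e hμ hadd₁ hadd₂ hgal κ v n hs hs1 g hbij a b)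
  rw [map_sum] at h
  exact h

/-- **One orbit** (`θ(Γ_v)·Γ_n = Γ_ℚ`: `ē : Γ_v ⧸ U_n → Γ_ℚ ⧸ Γ_n` onto — `v ∣ p` totally ramified, or `v` inert/undecomposed in `ℚ_n`):
`inv_v(loc_v(Sh_{Γ_n} a ∪_{Σe} Sh_{Γ_n} b)) = ⟨loc_n a, loc_n b⟩_{n,N,v}`. [cite: Kobayashi2003, (8.23) (p. 18)]
[cite: NeukirchSchmidtWingberg2008, I §6 Prop. (1.6.4), (1.6.5)] -/
theorem invAt_localization_cupProduct_shapiroLift_eq_of_surjective [CompactSpace (absoluteGaloisGroup ℚ)]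
    [CompactSpace (absoluteGaloisGroup (v.adicCompletion ℚ))] [Fintype (absoluteGaloisGroup ℚ ⧸ κ.layerSubgroup n)]
    {s : absoluteGaloisGroup ℚ ⧸ κ.layerSubgroup n → absoluteGaloisGroup ℚ}
    (hs : ∀ y, (s y : absoluteGaloisGroup ℚ ⧸ κ.layerSubgroup n) = y)
    (hs1 : s ((1 : absoluteGaloisGroup ℚ) : absoluteGaloisGroup ℚ ⧸ κ.layerSubgroup n) = 1)
    (hsurj : Function.Surjective
      (quotientMapOfHom (κ.layerSubgroup n) (resGalOfEmb (closureEmb (K := ℚ) (v.adicCompletion ℚ)))))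
    (a b : H1 ρM (κ.layerSubgroup n)) :
    invAt N v (galoisCohomology.localization (mu ℚ N) (Sum.inr v) 2
        (((contPairingOfFun ρM N e hμ hadd₁ hadd₂ hgal).coindFin (κ.layerSubgroup n)).cupProduct
          (shapiroLift ρM.toTopRep (κ.layerSubgroup n) (κ.isOpen_layerSubgroup n) hs hs1 a)
          (shapiroLift ρM.toTopRep (κ.layerSubgroup n) (κ.isOpen_layerSubgroup n) hs hs1 b))) =
      layerPairingH1Of ρM N e hμ hadd₁ hadd₂ hgal κ v n (layerLocOf ρM κ v n a) (layerLocOf ρM κ v n b) := by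
  have hbij : Function.Bijective fun q : Unit × (absoluteGaloisGroup (v.adicCompletion ℚ) ⧸ layerGroup κ v n) =>
      quotientMapOfHom (κ.layerSubgroup n) (resGalOfEmb (closureEmb (K := ℚ) (v.adicCompletion ℚ))) q.2 *
        (((fun _ : Unit => (1 : absoluteGaloisGroup ℚ)) q.1 : absoluteGaloisGroup ℚ) : absoluteGaloisGroup ℚ ⧸ κ.layerSubgroup n) := by
    have hinj := quotientMapOfHom_injective (κ.layerSubgroup n) (resGalOfEmb (closureEmb (K := ℚ) (v.adicCompletion ℚ)))
    constructor
    · rintro ⟨u₁, y₁⟩ ⟨u₂, y₂⟩ h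
      simp only [QuotientGroup.mk_one, mul_one] at h
      exact Prod.ext (Subsingleton.elim _ _) (hinj h)
    · intro y
      obtain ⟨y', hy'⟩ := hsurj y
      exact ⟨((), y'), by simp only [QuotientGroup.mk_one, mul_one]; exact hy'⟩
  rw [invAt_localization_cupProduct_shapiroLift_eq_sum ρM N e hμ hadd₁ hadd₂ hgal κ v n hs hs1 (fun _ : Unit => 1) hbij a b,
    Fintype.sum_unique]
  rw [conjMap_one_one, conjMap_one_one]

end CyclotomicLayer

end Literature.NumberTheory.EllipticCurves

end
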